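import Summits.BirchSwinnertonDyer.BirchSwinnertonDyer.Theorems.PrintX9HowardRankOne
import Summits.BirchSwinnertonDyer.BirchSwinnertonDyer.Theorems.PrintX9HeegnerDivisibility
import Summits.BirchSwinnertonDyer.BirchSwinnertonDyer.Theorems.PrintX9JetchevHeegnerDivisibilityX9
import HarnessLib

/-!
# Class X9: the leaf from JETCHEV on the single-carrier pairs and the HOWARD ROAD on the multi-carrier
# pairs — the X9 Heegner residual shrinks from `MultiPrimeX9` (no print, not certifiable per pair) to a
# FRAME SUPPLY on the multi-carrier rank-one pairs only (cell `bsd-print-x9`, prover seat p4, gen 3;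
# companion of `PrintX9HowardIMCLink.lean`, `PrintX9HowardRankOne.lean`, `PrintX9HeegnerDivisibility.lean`,
# `PrintX9JetchevHeegnerDivisibilityX9.lean`)

HONEST FRAMING (cell `run/shared/lean/pub/bsd-print-x9/`, D-0131 print tier): THEOREMS ONLY (no
definition, no named fact, no `sorry`); every published theorem enters as a named Literature fact BY
NAME; every unproved statement is an EXPLICIT binder (the K6 engine `IntegralMainConjectureOnClassX9` /
route items 19629 ∧ 19630, and the frame supply `hFS`). Nothing is asserted about any curve; the leaf
`BSDpOnClassX9` is NOT closed.

## What this file proves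

After p4 g2 the route's crux J = `HeegnerDivisibilityX9` (20392) is, in the kernel, `MultiPrimeX9 ∧ three
image-free print heads` (`JET.Split.heegnerDivisibilityX9_of_multiCarrier_of_printFacts_routeFree`,
p564241): Jetchev's global divisibility at the irreducible non-surjective X9 image handles every pair
at which ONE bad prime `q` carries the whole `p`-adic Tamagawa depth (`ord_p ∏ c_ℓ ≤ ord_p c_q`). The
companion `PrintX9HowardRankOne.lean` reaches `BSD(E,p)` at ANY rank-one X9 pair WITHOUT J, given a
Heegner frame with `p ∤ h_K` (Mastella–Zerman Cor. 4.6 ∘ Yan–Zhu/BCS/CGLS composite ∘ JSW 3.3.1). Here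
the two are COMBINED pair by pair:

* §1 `X9.bsdp_rankOne_of_heegnerDivisibilityAt_of_x9IntegralMainConjecture` — the per-PAIR form of
  p4 g0's `X9.bsdp_rankOne_of_heegnerDivisibilityX9_of_x9IntegralMainConjecture`: the J road at `(E, p)`
  from J's conclusion AT THAT PAIR (`hJp`) instead of the class-wide route decl (same proof; the sharp
  upper bound `X9.shaIndexBound_sharp_of_globalDivisibility` is REUSED from `PrintX9HeegnerDivisibility.lean`
  — the gate's dedup rule forbids a route-free copy, so this module sits in the `Theses.PrintX9` cone like
  that file).
* §2 `bsdpOnClassX9_of_heegnerFrameSupplyMultiCarrier_of_jetchevPrintFacts_of_cor46_of_integralMainConjectureOnClassX9`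
  and `…_of_katoMuTransfer` — the LEAF from: the three print heads of `JetchevPrintFactsX9` (`hPF`,
  single-carrier pairs via `JET.Split.jetchevX9_of_namedFacts`), Mastella–Zerman Cor. 4.6 (`h46`) + the
  composite (`hYZ`) (multi-carrier pairs via the Howard frame), the K6 engine (resp. 19629 ∧ 19630), the
  published facts of both roads, and the FRAME SUPPLY ON THE MULTI-CARRIER RANK-ONE PAIRS ONLY:
  `hFS` = «every X9 pair with `ord_{s=1}L(E,s) = 1` at which NO single bad prime carries `ord_p ∏ c_ℓ` has
  an imaginary quadratic `K` with `d_K` odd `< −4`, every `ℓ ∣ N_E` and `p` split, `p ∤ h_K`,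
  `L(E^{d_K},1) ≠ 0`» (the negated single-carrier clause is `stub_multiPrime`'s, VERBATIM).

So the X9 Heegner residual of route `PrintX9` can be booked EITHER as `MultiPrimeX9` (Jetchev–BCGS
`M_∞ ≥ Σ ord_p c_q` at non-surjective image: no printed source, not single-instance refutable) OR as this
frame supply (per pair a FINITE certificate — a Heegner discriminant `D` with `p ∤ h(D)` and
`L(E_D, 1) ≠ 0`; lit DOSSIER §33 counts such frames on disk for 129/135 live pairs —; class-wide an
analytic statement of Kohnen–Ono / Hoffstein–Luo type). «beyond-print theorem»: NO (composite of print;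
the beyond-print theorem of this road remains `JET.Split.jetchevX9_of_namedFacts`).

References: [Jetchev2008] Thm. 1.4; [MastellaZerman2026] Cor. 4.6; [YanZhu2024MainConjNonCM] Thm. 5.7
(1), 5.9; [BurungaleCastellaSkinner2025] Thm. 1.2.4 (a), Prop. 4.2.2, Cor. 1.3.1; [Cha2005] Rmk. 25;
[JetchevSkinnerWan2017] Thm. 3.3.1; [HoffsteinLuo1997]; [Howard2004HeegnerKolyvagin] §3 (p ∤ h_K);
route file `Theses/PrintX9.lean` (rev 3), HOME/p4/children-20392.md.
-/

set_option linter.dupNamespace false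
set_option autoImplicit false

noncomputable section

open scoped Classical MatrixGroups ModularForm

open CongruenceSubgroup WeierstrassCurve NumberField IsDedekindDomain
  Literature.NumberTheory.EllipticCurves Literature.NumberTheory.EllipticCurves.ModularForms
  Literature.NumberTheory.EllipticCurves.BurungaleCastellaSkinner2025
  Literature.NumberTheory.EllipticCurves.JetchevSkinnerWan2017
  Literature.NumberTheory.EllipticCurves.YanZhu2026
  Summit.BirchSwinnertonDyer.BirchSwinnertonDyer.Theorems.Rank1ResidualX1Defs
  Summit.BirchSwinnertonDyer.Rank1Residual
  Summit.BirchSwinnertonDyer.Rank1Residual.X11b.Three.Koly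
  Summit.BirchSwinnertonDyer.Rank1Residual.X11b.KolyvaginBottom

open Literature.NumberTheory.EllipticCurves.Rank1Residual (GoodOrd Irr Surj BigIm
  norm_periodRatio_eq_one pPart_of_bsdp not_dvd_discr_of_split)

namespace Summit.BirchSwinnertonDyer.BirchSwinnertonDyer.Rank1Residual

/-! ### §1 The J road at ONE pair, from J's conclusion at that pair -/

/-- **Rank one on class X9 at the pair, ANY Tamagawa numbers, from J's conclusion AT THE PAIR (`hJp`), the
K6 typed rank-`0` engine and PUBLISHED named facts** — literally p4 g0's
`X9.bsdp_rankOne_of_heegnerDivisibilityX9_of_x9IntegralMainConjecture` with the class-wide route decl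
`HeegnerDivisibilityX9` replaced by its instance at `(E, p)`: Hoffstein–Luo field with `|d_K| > max(B, 4)`,
Darmon's conductor-`1` datum, Cha Rmk. 25 fed by `hJp` (Tamagawa-sharp upper bound), STEP L from BCS
1.2.4 (a) + 4.2.2 ∘ CGLS 5.1.3 + JSW 3.3.1, descent with the twist's rank-`0` `p`-part from `hIMC`. Used
on the SINGLE-CARRIER pairs, where `hJp` is Jetchev's theorem at the X9 image
(`JET.Split.jetchevX9_of_namedFacts`). [cite: Cha2005, Rmk. 25 (p. 175)] [cite: Jetchev2008, Thm. 1.4]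
[cite: BurungaleCastellaSkinner2025, Thm. 1.2.4 (a), Prop. 4.2.2, Cor. 1.3.1 (proof, p. 4)]
[cite: JetchevSkinnerWan2017, Thm. 3.3.1, §7.4.1] [cite: Darmon2004, Thm. 3.6] [cite: Miller2011LMS, Def. 1.1] -/
theorem X9.bsdp_rankOne_of_heegnerDivisibilityAt_of_x9IntegralMainConjecture
    -- published inputs (named facts of the tree)
    (hGZ : ∀ (N : ℕ) [NeZero N] (W : WeierstrassCurve ℚ) (K : Type) [Field K] [NumberField K],
      gross_zagier N W K)
    (hKo : ∀ (N : ℕ) [NeZero N] (W : WeierstrassCurve ℚ) (K : Type) [Field K] [NumberField K],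
      kolyvagin N W K)
    (hrec : ∀ (N : ℕ) [NeZero N] (W : WeierstrassCurve ℚ) (K : Type) [Field K] [NumberField K],
      heegnerPointOfConductor_one_galoisConj N W K)
    (hD36 : ∀ (N : ℕ) [NeZero N] (W : WeierstrassCurve ℚ) (K : Type) [Field K] [NumberField K],
      phi_heegnerTau_mem_singularModuliField N W K)
    (hChaU : Cha2005.rmk25_padicValNat_card_sha_primary_add_le_of_globalDivisibility)
    (h526 : MatarNekovar2019.prop526_hasIrreducibleModPGaloisRep_baseChange)
    (h124a : thm124a_prop422_thm513_generator_constantCoeff)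
    (h331 : thm331_anticyclotomicControl)
    (hGr : greenberg_charValue_rankZero) (hGZK : rank_eq_analyticRank_of_analyticRank_le_one)
    (hmod : hasEntireLFunction_rat) (hpar : nonempty_modularParametrizationData)
    (hnf : exists_isNewformOf) (hHL : HoffsteinLuo1997_exists_twist_L_one_ne_zero)
    (hMaz : mazur_not_dvd_maninConstant_of_odd) (hNS : integral_neronScaling_of_isGloballyMinimal)
    (h5 : realPeriodRat_eq_unit_mul_plusPeriod)
    -- the pair
    (W : WeierstrassCurve ℚ) [W.IsElliptic] [W.IsGloballyMinimal] [NeZero (W.conductorNorm ℤ)] (p : ℕ)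
    [Fact p.Prime] (hX9 : ClassX9 W p) (hr : W.analyticRank = 1)
    -- J's conclusion AT THIS PAIR
    (hJp : ∃ B : ℕ, ∀ (K : Type) [Field K] [NumberField K]
      (Dt : ModularParametrizationData W (W.conductorNorm ℤ)) (β : ℤ) (ι : K →+* ℂ),
      IsImaginaryQuadratic K → B < (NumberField.discr K).natAbs →
      SatisfiesHeegnerHypothesis (W.conductorNorm ℤ) K → SatisfiesHeegnerHypothesis p K →
      (4 * (W.conductorNorm ℤ : ℤ)) ∣ β ^ 2 - NumberField.discr K → ¬ (p : ℤ) ∣ Dt.c →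
      ∀ (d₁ : KolyvaginHeegnerData Dt β ι 1), ¬ IsOfFinAddOrder d₁.derivedPoint →
      ∀ (s : ℕ), s ≤ padicValNat p W.tamagawaProduct →
      ∀ (n : ℕ) (d : KolyvaginHeegnerData Dt β ι n), Squarefree n →
        (∀ ℓ ∈ n.primeFactors, Zhang2014.IsKolyvaginPrime (W.conductorNorm ℤ) W K p ℓ ∧
          s ≤ Zhang2014.kolyvaginIndex W p ℓ) →
        ∃ Q : (W.baseChange (ringClassField K ι n)).toAffine.Point, ((p ^ s : ℕ) : ℤ) • Q = d.derivedPoint)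
    -- the K6 typed rank-`0` engine
    (hIMC : IntegralMainConjectureOnClassX9) : BSDp W p := by
  obtain ⟨hcm, hp5, hgood, hord, hirr, hns⟩ := id hX9
  have hpP : p.Prime := Fact.out
  have hp2 : p ≠ 2 := by omega
  obtain ⟨B, hB⟩ := hJp
  -- the sign of the functional equation is `−1`
  have hw : W.rootNumber = -1 := by
    rw [WeierstrassCurve.rootNumber_eq_neg_one_pow_analyticRank_of_exists_isNewformOf hnf W, hr]
    norm_num
  -- the field (Hoffstein–Luo) with `|d_K| > max(B, 4)`
  obtain ⟨d, hdneg, hsq, hd8, hBd, hjacS, hjacN, hLd⟩ :=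
    exists_neg_fundamental_twist_ne_zero_of_hoffsteinLuo hnf hHL W hw {p} (max B 4)
  have hkr : ∀ q : ℕ, q.Prime → q ∣ W.conductorNorm ℤ * p →
      (q = 2 → d % 8 = 1) ∧ (q ≠ 2 → jacobiSym d q = 1) := by
    intro q hq hqNp
    refine ⟨fun _ ↦ hd8, fun hq2 ↦ ?_⟩
    rcases (Nat.Prime.dvd_mul hq).mp hqNp with hqN | hqp
    · exact hjacN q hq hqN hq2
    · have hqp' : q = p := (Nat.prime_dvd_prime_iff_eq hq hpP).mp hqp
      subst hqp'
      exact hjacS q (Finset.mem_singleton_self q) hq hq2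
  obtain ⟨K, _, _, hK, hBK, hH, hd8K, hLt⟩ :=
    (exists_heegnerField_iff_exists_fundamental (W.conductorNorm ℤ * p) (max B 4)
      (fun D ↦ D % 8 = 1 ∧ (W.quadraticTwist (D : ℚ)).entireLFunction 1 ≠ 0)).mpr
      ⟨d, hdneg, Or.inl ⟨by omega, hsq, by omega⟩, hBd, hkr, hd8, hLd⟩
  have hneg : NumberField.discr K < 0 := IsImaginaryQuadratic.discr_neg hK
  have hodd : Odd (NumberField.discr K) := Int.odd_iff.mpr (by omega)
  have h4K : 4 < (NumberField.discr K).natAbs := lt_of_le_of_lt (le_max_right B 4) hBK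
  have hBK' : B < (NumberField.discr K).natAbs := lt_of_le_of_lt (le_max_left B 4) hBK
  have hlt : NumberField.discr K < -4 := by omega
  have hHN : SatisfiesHeegnerHypothesis (W.conductorNorm ℤ) K := hH.of_dvd (dvd_mul_right _ _)
  have hHp : SatisfiesHeegnerHypothesis p K := hH.of_dvd (dvd_mul_left _ _)
  have h3 : NumberField.discr K ≠ -3 := by omega
  have h4 : NumberField.discr K ≠ -4 := by omega
  -- `p ∤ d_K` and `w_K = 2`
  have hpd : ¬ (p : ℤ) ∣ NumberField.discr K := not_dvd_discr_of_split hK hpP hp2 hHp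
  have hμ : ¬ p ∣ Units.torsionOrder K := by
    haveI : IsTotallyComplex K := hK.2
    rw [Literature.NumberTheory.DiophantineGeometry.torsionOrder_eq_two_of_discr_lt hK.1 hlt]
    intro hdvd
    have := Nat.le_of_dvd two_pos hdvd
    omega
  -- (irred_K) at this field (Matar–Nekovář Prop. 5.26 (2))
  have hirrK : (W.baseChange K).HasIrreducibleModPGaloisRep p :=
    h526 W K hK.1 (Literature.SatisfiesHeegnerHypothesis.coprime_discr hK.1 hHN) p hp2 hirr
  -- the Manin-unit Heegner datum at the good prime `p`
  obtain ⟨Dt, H, ι, P, hP, hc⟩ :=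
    X11b.exists_maninDatum_of_good hnf hMaz hNS W p (W.conductorNorm ℤ) K rfl hp2 hgood hirr hK hHN
  have hPinf : ¬ IsOfFinAddOrder P :=
    X11b.not_isOfFinAddOrder_of_heegner_of_analyticRank_eq_one W (W.conductorNorm ℤ) K Dt H ι P
      (hGZ _ W K) hmod hr hK hHN hLt hP
  -- rank one and finiteness over `K` (Kolyvagin), no `p`-torsion (irreducibility)
  obtain ⟨hrank, hshaK⟩ := hKo (W.conductorNorm ℤ) W K hK hHN ⟨Dt, H, ι, hP⟩ hPinf
  haveI : Finite (W.baseChange K).sha := hshaK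
  have hbot := torsionBy_eq_bot_of_isImaginaryQuadratic_of_hasIrreducibleModPGaloisRep W K hK hpP hirr
  have hiv : ∀ x : (W.baseChange K).toAffine.Point, p • x = 0 → x = 0 := fun x hx ↦ by
    have hmem : x ∈ AddSubgroup.torsionBy (W.baseChange K).toAffine.Point ((p : ℕ) : ℤ) := by
      rw [mem_torsionBy_iff, natCast_zsmul]
      exact hx
    rw [hbot] at hmem
    exact hmem
  -- Darmon's conductor-1 datum on the frame (Dt, H.β, ι); its bottom point is `P`
  obtain ⟨d₁⟩ := exists_kolyvaginHeegnerData_one (hD36 _ W K) hK Dt H.β ι H.dvd_sq_sub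
  have hPd : d₁.toGeomPoints d₁.derivedPoint = toGeomPoints (W.baseChange K) P :=
    toGeomPoints_derivedPoint_one_eq (hrec _ W K) hK hHN hP d₁ rfl
  have hd₁inf : ¬ IsOfFinAddOrder d₁.derivedPoint := fun hfin ↦
    hPinf ((isOfFinAddOrder_derivedPoint_one_iff (hrec _ W K) hK hHN hP d₁ rfl).mp hfin)
  -- STEP U, Tamagawa-sharp: J at this frame + Cha Rmk. 25
  have hU : padicValNat p (Nat.card (W.baseChange K).sha) + 2 * padicValNat p W.tamagawaProduct ≤
      2 * padicValNat p (AddSubgroup.zmultiples P).index :=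
    X9.shaIndexBound_sharp_of_globalDivisibility hChaU W K p hp2 hcm hgood hirr hK h3 h4 hHN hHp Dt
      H.β ι d₁ P hPd hPinf hrank hiv
      (fun s hs n dn hn hℓ ↦ hB K Dt H.β ι hK hBK' hHN hHp H.dvd_sq_sub hc d₁ hd₁inf s hs n dn hn hℓ)
  -- STEP L: (IMC≥∘BDP)ᵍ from BCS 1.2.4 (a) + 4.2.2 ∘ CGLS 5.1.3, control from JSW 3.3.1
  obtain ⟨κ, γ, 𝔭, hκ, hγ, h𝔭⟩ := X11b.exists_anticyclotomic_generator_prime (p := p) hK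
  haveI : Fact (κ.IsTopGenerator γ) := ⟨hγ⟩
  have hsplit : X11b.SplitsIn K p := hHp p Fact.out (dvd_refl p)
  obtain ⟨he, hf⟩ := X11b.degreeOne_of_splitsIn hK.1 hsplit h𝔭
  set ιp : K →+* ℚ_[p] := X11b.embAt K p 𝔭 h𝔭 he hf with hιp
  have hL : X11b.IndexLowerBoundAt W p K P :=
    X11b.indexLowerBoundAt_of_heegner_of_thm331_of_embedding (γ := γ) W p (W.conductorNorm ℤ) K Dt H
      ι P h331 (hGZ _ W K) (hKo _ W K) hmod hGZK (by omega) hgood hr rfl hK hHN hHp hirrK hLt hP hκ ιp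
      (X11b.imcLowerWaldspurgerOnTreeGoodAt_inducedPlace_of_heegner_of_thm124a_of_thm331 (γ := γ) W p
        (W.conductorNorm ℤ) K Dt H ι P h124a h331 (hKo _ W K) (by omega) ⟨hgood, hord⟩ hirr hirrK rfl
        hK hodd hlt hHN hHp hP hc hPinf hκ ιp)
  -- the identity over `K`
  have hid : Finite (W.baseChange K).sha → X11b.IndexIdentityAt W p K P := fun _ ↦
    X9.indexIdentityAt_of_lowerBound_of_sharpUpper W p hL hU
  -- a globally minimal model of the twist (Néron), its X9 transports, its rank-`0` `p`-part
  have hD0 : (NumberField.discr K : ℚ) ≠ 0 := by exact_mod_cast NumberField.discr_ne_zero K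
  haveI hEt : (W.quadraticTwist (NumberField.discr K : ℚ)).IsElliptic :=
    W.isElliptic_quadraticTwist hD0
  obtain ⟨Cd, hCd⟩ := hasGlobalMinimalModel_rat_holds (W.quadraticTwist (NumberField.discr K : ℚ))
  haveI : (Cd • W.quadraticTwist (NumberField.discr K : ℚ)).IsGloballyMinimal := hCd
  have hWd : Cd • W.quadraticTwist (NumberField.discr K : ℚ) =
      Cd • W.quadraticTwist (NumberField.discr K : ℚ) := rfl
  have hX9d : ClassX9 (Cd • W.quadraticTwist (NumberField.discr K : ℚ)) p :=
    classX9_twist_model hX9 K hK.1 hpd Cd hWd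
  have hordd : GoodOrd (Cd • W.quadraticTwist (NumberField.discr K : ℚ)) p :=
    ⟨hX9d.2.2.1, hX9d.2.2.2.1⟩
  have htam : padicValNat p (Cd • W.quadraticTwist (NumberField.discr K : ℚ)).tamagawaProduct =
      padicValNat p W.tamagawaProduct :=
    X2.padicValNat_tamagawaProduct_twist_of_heegner_of_odd W p hp2 K hK hodd hpd hHN Cd hWd
  have hu : padicValRat p (Cd.u : ℚ) = 0 :=
    X11b.padicValRat_u_eq_zero_of_twist_good W p hpd hgood Cd hWd hordd.1
  have hMCd : MazurMainConjecture (Cd • W.quadraticTwist (NumberField.discr K : ℚ)) p :=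
    mazurMainConjecture_of_integralMainConjectureOnClassX9 h5 hIMC hX9d
  exact X11b.bsdp_rankOne_of_indexIdentityAt_of_twist_mazurMainConjecture W p (W.conductorNorm ℤ) K Dt
    H ι P (hGZ _ W K) (hKo _ W K) hGr hGZK hmod hpar hr hp2 hK hHN hP hc hμ hLt
    (Cd • W.quadraticTwist (NumberField.discr K : ℚ)) Cd hWd hordd htam hu hMCd hid

/-! ### §2 The LEAF: Jetchev on the single-carrier pairs, the Howard frame on the multi-carrier pairs -/

/-- **`BSDpOnClassX9` ⟸ PUBLISHED named facts ∧ `IntegralMainConjectureOnClassX9` (K6 rank-`0` engine) ∧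
the three print heads of `JetchevPrintFactsX9` (`hPF`) ∧ Mastella–Zerman Cor. 4.6 (`h46`) ∧ the
Yan–Zhu/BCS/CGLS composite (`hYZ`) ∧ the FRAME SUPPLY ON THE MULTI-CARRIER RANK-ONE PAIRS (`hFS`).**
Rank `0`: the K6 engine. Rank `1`, single carrier (`∃ q ∣ N_E` prime with `ord_p ∏ c_ℓ ≤ ord_p c_q`):
Jetchev's theorem at the X9 image (`JET.Split.jetchevX9_of_namedFacts hPF…` at `q`) gives J at the pair,
then §1. Rank `1`, multi-carrier: `hFS` supplies a Heegner field with `p ∤ h_K` and `L(E^{d_K},1) ≠ 0`,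
then the Howard road (`X9.bsdp_rankOne_of_howardFrame_of_x9IntegralMainConjecture`). `hFS`'s negated
clause is `stub_multiPrime`'s / `MultiPrimeX9`'s VERBATIM. Nothing is booked: `hFS`, `hIMC` are OPEN;
`hPF`, `h46`, `hYZ` and the rest are named Literature facts (flags travel with them:
`Cha05-Rmk25-structure`, `BCS25-124a+422-mu-composite`, `YZ26-57i+59+BCS422+CGLS513-composite`).
[cite: Jetchev2008, Thm. 1.4 (p. 812)] [cite: MastellaZerman2026, Cor. 4.6]
[cite: YanZhu2024MainConjNonCM, Thm. 5.7 (1), Thm. 5.9] [cite: BurungaleCastellaSkinner2025, Cor. 1.3.1 (proof, p. 4)]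
[cite: Cha2005, Rmk. 25] [cite: JetchevSkinnerWan2017, Thm. 3.3.1] [cite: Miller2011LMS, §1 and Def. 1.1] -/
theorem bsdpOnClassX9_of_heegnerFrameSupplyMultiCarrier_of_jetchevPrintFacts_of_cor46_of_integralMainConjectureOnClassX9
    (hGZ : ∀ (N : ℕ) [NeZero N] (W : WeierstrassCurve ℚ) (K : Type) [Field K] [NumberField K],
      gross_zagier N W K)
    (hKo : ∀ (N : ℕ) [NeZero N] (W : WeierstrassCurve ℚ) (K : Type) [Field K] [NumberField K],
      kolyvagin N W K)
    (hrec : ∀ (N : ℕ) [NeZero N] (W : WeierstrassCurve ℚ) (K : Type) [Field K] [NumberField K],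
      heegnerPointOfConductor_one_galoisConj N W K)
    (hD36 : ∀ (N : ℕ) [NeZero N] (W : WeierstrassCurve ℚ) (K : Type) [Field K] [NumberField K],
      phi_heegnerTau_mem_singularModuliField N W K)
    (hChaU : Cha2005.rmk25_padicValNat_card_sha_primary_add_le_of_globalDivisibility)
    (h526 : MatarNekovar2019.prop526_hasIrreducibleModPGaloisRep_baseChange)
    (h124a : thm124a_prop422_thm513_generator_constantCoeff)
    (h331 : thm331_anticyclotomicControl)
    (h46 : MastellaZerman2026.cor46_howardDivisibility_of_scalarImage.{0})
    (hYZ : thm57_thm59_bcs422_cgls513_generator_constantCoeff_of_heegnerDivisibility)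
    (hGr : greenberg_charValue_rankZero) (hGZK : rank_eq_analyticRank_of_analyticRank_le_one)
    (hmod : hasEntireLFunction_rat) (hpar : nonempty_modularParametrizationData)
    (hnf : exists_isNewformOf) (hHL : HoffsteinLuo1997_exists_twist_L_one_ne_zero)
    (hMaz : mazur_not_dvd_maninConstant_of_odd) (hNS : integral_neronScaling_of_isGloballyMinimal)
    (h5 : realPeriodRat_eq_unit_mul_plusPeriod)
    -- the three print heads of `JetchevPrintFactsX9` (bundle shape of the 20392 split)
    (hPF : Literature.NumberTheory.EllipticCurves.GrossLMS1991.prop37_2_frobeniusCongruence ∧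
      (∀ (K : Type) [Field K] [NumberField K],
        Literature.NumberTheory.GaloisCohomology.poitouTate_selmerStructure_duality_conj K) ∧
      Literature.NumberTheory.EllipticCurves.Gross1991_heegnerPoint_sub_ratTorsion_mem_E0_imageFree)
    -- the FRAME SUPPLY on the multi-carrier rank-one pairs (OPEN; per pair a finite certificate)
    (hFS : ∀ (W : WeierstrassCurve ℚ) [W.IsElliptic] [W.IsGloballyMinimal] [NeZero (W.conductorNorm ℤ)]
      (p : ℕ) [Fact p.Prime], Literature.NumberTheory.EllipticCurves.Rank1Residual.ClassX9 W p →
      W.analyticRank = 1 →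
      ¬ (∃ (q : ℕ) (_ : Fact q.Prime), q ∣ W.conductorNorm ℤ ∧ padicValNat p W.tamagawaProduct ≤
        padicValNat p ((W.baseChange ℚ_[q]).localTamagawaNumber ℤ_[q])) →
      ∃ (K : Type) (_ : Field K) (_ : NumberField K), IsImaginaryQuadratic K ∧
        Odd (NumberField.discr K) ∧ NumberField.discr K < -4 ∧
        SatisfiesHeegnerHypothesis (W.conductorNorm ℤ) K ∧ SatisfiesHeegnerHypothesis p K ∧
        ¬ p ∣ NumberField.classNumber K ∧
        (W.quadraticTwist (NumberField.discr K : ℚ)).entireLFunction 1 ≠ 0)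
    -- the K6 typed rank-`0` engine
    (hIMC : IntegralMainConjectureOnClassX9) : BSDpOnClassX9 := by
  intro W _ _ p _ hran hX9 _
  obtain ⟨-, hp5, hgood, hord, -, -⟩ := id hX9
  have hbsdp : BSDp W p := by
    rcases Nat.lt_or_ge W.analyticRank 1 with h0 | h1
    · exact bsdp_of_mazurMainConjecture_of_analyticRank_eq_zero hGr hpar hGZK (by omega) ⟨hgood, hord⟩
        (by omega) (mazurMainConjecture_of_integralMainConjectureOnClassX9 h5 hIMC hX9)
    · have hr : W.analyticRank = 1 := le_antisymm hran h1
      haveI : NeZero (W.conductorNorm ℤ) := ⟨(W.conductorNorm_pos_holds).ne'⟩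
      have hX9c := classX9_census_of_classX9 W p hX9
      by_cases hR : (∃ (q : ℕ) (_ : Fact q.Prime), q ∣ W.conductorNorm ℤ ∧
          padicValNat p W.tamagawaProduct ≤ padicValNat p ((W.baseChange ℚ_[q]).localTamagawaNumber ℤ_[q]))
      · -- single carrier: Jetchev at the X9 image (kernel modulo the three print heads), then §1
        obtain ⟨B, hB⟩ := JET.Split.jetchevX9_of_namedFacts hPF.1 hPF.2.1 hPF.2.2 W p hX9c hr.le
        obtain ⟨q, hq, hqN, hle⟩ := hR
        haveI : Fact q.Prime := hq
        refine X9.bsdp_rankOne_of_heegnerDivisibilityAt_of_x9IntegralMainConjecture hGZ hKo hrec hD36 hChaU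
          h526 h124a h331 hGr hGZK hmod hpar hnf hHL hMaz hNS h5 W p hX9 hr ⟨B, ?_⟩ hIMC
        intro K _ _ Dt β ι hK hBK hH hHp hβ hc d₁ hd₁ s hs n d hn hℓ
        exact hB K Dt β ι hK hBK hH hHp hβ hc d₁ hd₁ q hqN s (hs.trans hle) n d hn hℓ
      · -- multi-carrier: the Howard frame
        obtain ⟨K, _, _, hK, hodd, hlt, hHN, hHp, hhK, hLt⟩ := hFS W p hX9c hr hR
        exact X9.bsdp_rankOne_of_howardFrame_of_x9IntegralMainConjecture h46 hYZ h331 hGZ hKo hGr hGZK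
          hmod hpar hnf hMaz hNS h5 W p hX9 hr K hK hodd hlt hHN hHp hhK hLt hIMC
  exact (pPartBSD_iff_pPart W p).mpr (pPart_of_bsdp hmod hGZK W p hran hbsdp)

/-- **The same from route `PrintX9`'s μ-items: FRAME SUPPLY (multi-carrier) → `JetchevPrintFactsX9` heads →
Mastella–Zerman / composite → `KatoMuTransfer` (19629) → `AnalyticMuZeroOnClassX9` (19630) → PUBLISHED
facts → `BSDpOnClassX9`.** Compared with the route's landed assembly
(`bsdpOnClassX9_of_heegnerDivisibilityX9_of_katoMuTransfer`), the crux J (20392) is replaced by its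
kernel single-carrier half (theorem) plus the multi-carrier frame supply `hFS`.
[cite: Jetchev2008, Thm. 1.4] [cite: MastellaZerman2026, Cor. 4.6] [cite: Kato2004Asterisque, Thm. 12.5, 17.4]
[cite: GreenbergLNM1716, Conj. 1.11, Thm. 4.1] -/
theorem bsdpOnClassX9_of_heegnerFrameSupplyMultiCarrier_of_jetchevPrintFacts_of_cor46_of_katoMuTransfer
    (hGZ : ∀ (N : ℕ) [NeZero N] (W : WeierstrassCurve ℚ) (K : Type) [Field K] [NumberField K],
      gross_zagier N W K)
    (hKo : ∀ (N : ℕ) [NeZero N] (W : WeierstrassCurve ℚ) (K : Type) [Field K] [NumberField K],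
      kolyvagin N W K)
    (hrec : ∀ (N : ℕ) [NeZero N] (W : WeierstrassCurve ℚ) (K : Type) [Field K] [NumberField K],
      heegnerPointOfConductor_one_galoisConj N W K)
    (hD36 : ∀ (N : ℕ) [NeZero N] (W : WeierstrassCurve ℚ) (K : Type) [Field K] [NumberField K],
      phi_heegnerTau_mem_singularModuliField N W K)
    (hChaU : Cha2005.rmk25_padicValNat_card_sha_primary_add_le_of_globalDivisibility)
    (h526 : MatarNekovar2019.prop526_hasIrreducibleModPGaloisRep_baseChange)
    (h124a : thm124a_prop422_thm513_generator_constantCoeff)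
    (h331 : thm331_anticyclotomicControl)
    (h46 : MastellaZerman2026.cor46_howardDivisibility_of_scalarImage.{0})
    (hYZ : thm57_thm59_bcs422_cgls513_generator_constantCoeff_of_heegnerDivisibility)
    (hBCS : burungale_castella_skinner_charIdeal_eq_padicLFunction)
    (hGr : greenberg_charValue_rankZero) (hGZK : rank_eq_analyticRank_of_analyticRank_le_one)
    (hmod : hasEntireLFunction_rat) (hpar : nonempty_modularParametrizationData)
    (hnf : exists_isNewformOf) (hHL : HoffsteinLuo1997_exists_twist_L_one_ne_zero)
    (hMaz : mazur_not_dvd_maninConstant_of_odd) (hNS : integral_neronScaling_of_isGloballyMinimal)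
    (h5 : realPeriodRat_eq_unit_mul_plusPeriod)
    (hPF : Literature.NumberTheory.EllipticCurves.GrossLMS1991.prop37_2_frobeniusCongruence ∧
      (∀ (K : Type) [Field K] [NumberField K],
        Literature.NumberTheory.GaloisCohomology.poitouTate_selmerStructure_duality_conj K) ∧
      Literature.NumberTheory.EllipticCurves.Gross1991_heegnerPoint_sub_ratTorsion_mem_E0_imageFree)
    (hFS : ∀ (W : WeierstrassCurve ℚ) [W.IsElliptic] [W.IsGloballyMinimal] [NeZero (W.conductorNorm ℤ)]
      (p : ℕ) [Fact p.Prime], Literature.NumberTheory.EllipticCurves.Rank1Residual.ClassX9 W p →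
      W.analyticRank = 1 →
      ¬ (∃ (q : ℕ) (_ : Fact q.Prime), q ∣ W.conductorNorm ℤ ∧ padicValNat p W.tamagawaProduct ≤
        padicValNat p ((W.baseChange ℚ_[q]).localTamagawaNumber ℤ_[q])) →
      ∃ (K : Type) (_ : Field K) (_ : NumberField K), IsImaginaryQuadratic K ∧
        Odd (NumberField.discr K) ∧ NumberField.discr K < -4 ∧
        SatisfiesHeegnerHypothesis (W.conductorNorm ℤ) K ∧ SatisfiesHeegnerHypothesis p K ∧
        ¬ p ∣ NumberField.classNumber K ∧
        (W.quadraticTwist (NumberField.discr K : ℚ)).entireLFunction 1 ≠ 0)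
    (h1 : KatoMuTransfer) (h2 : AnalyticMuZeroOnClassX9) : BSDpOnClassX9 :=
  bsdpOnClassX9_of_heegnerFrameSupplyMultiCarrier_of_jetchevPrintFacts_of_cor46_of_integralMainConjectureOnClassX9
    hGZ hKo hrec hD36 hChaU h526 h124a h331 h46 hYZ hGr hGZK hmod hpar hnf hHL hMaz hNS h5 hPF hFS
    (integralMainConjectureOnClassX9_of_katoMuTransfer hBCS h1 h2)

end Summit.BirchSwinnertonDyer.BirchSwinnertonDyer.Rank1Residual

end
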